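import Literature.NumberTheory.EllipticCurves.SigmaSqDivisionBridgeProofs
import Mathlib.NumberTheory.Padics.Hensel
import HarnessLib

/-!
# The `ℚ₂`-rational canonical `2`-torsion abscissa at an ordinary `2`, and normalised odd formal solutions of the
# Mazur–Tate equation for EVERY constant (inputs of the squared `2`-isogeny functional equation; route-independent)

Cell `bsd-f1-sign2`, WIDTH-5 attach seat `bsd-line-att-p3` g8 (`--supports stmt-BirchSwinnertonDyer-23008`; discharge plan
`Cruxes/BSDOfMainConjectureRankOneAtTwo/SIGMASQ-AT-TWO-att-p3.md`, steps S2 and S5). THEOREMS ONLY. BSD is not proved by any of this.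

* §1 `exists_canonical_twoTorsionX` — **at an ordinary `2` the canonical subgroup `μ₂ ⊂ E[2]` is `ℚ₂`-rational**: for a
  `2`-integral equation with `a₁ ∈ ℤ₂ˣ` the monic cubic `X³ + b₂X² + 8b₄X + 16b₆` (= `16·ψ₂²(X/4)`) has a UNIT root `X₀ ≡ −b₂ (mod 2)`
  (Hensel from `X = −b₂`: `F(−b₂) = 8(2b₆ − b₂b₄)`, `F'(−b₂) = b₂² + 8b₄ ∈ ℤ₂ˣ`), unique among odd elements; `e := X₀/4 ∈ ¼ℤ₂ˣ` is
  a `2`-torsion abscissa of `V ⊗ ℚ₂`: `4e³ + b₂e² + 2b₄e + b₆ = 0` (`twoTorsion_of_canonical`) — the hypothesis `he` of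
  `X_sq_mul_sq_subst_eq_of_twoIsogeny` (`…SigmaSqTwoIsogenyFE.lean`), with `‖e‖ = 4` (`Q = (e, −(a₁e + a₃)/2)` lies in the formal
  group `Ê(2ℤ₂) ∖ Ê(4ℤ₂)`).
* §2 `exists_isFormallyOdd_satisfiesSigmaODE_const` — on every `V/ℚ_p` and for EVERY `c ∈ ℚ_p` there is a normalised odd formal
  solution of `x + c = −D(Dσ/σ)` (tree: some `c₀`; twist by `exp(ε·log²)`) — so the constants `c, c'` in the functional equation
  may be prescribed, e.g. subject to `r₀ + π²c' − 2c − e = 0`.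

## Sources
* J. H. Silverman, *AEC* 2nd ed., III.1 (`ψ₂² = 4x³ + b₂x² + 2b₄x + b₆`), IV.3, VII.3 (torsion in the formal group).
  [cite: SilvermanAEC2009, VII.3 Prop. 3.1]
* N. M. Katz, *p-adic properties of modular schemes and modular forms*, LNM 350 (1973), §3 (canonical subgroup = kernel of Frobenius,
  `μ_p` at an ordinary point). [cite: MazurTate1991, Thm. 3.1]
* B. Mazur, W. Stein, J. Tate, Doc. Math. Extra Vol. (2006), §3.1 (formal solutions for every constant). [cite: MazurSteinTate2006, Thm. 1.3]
-/

noncomputable section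

set_option linter.dupNamespace false
set_option autoImplicit false

open scoped Classical
open PowerSeries WeierstrassCurve Literature.NumberTheory.EllipticCurves

namespace Summit.BirchSwinnertonDyer.BirchSwinnertonDyer.Theorems.AlignedTransportAtTwoSigmaSqTwo

/-! ## §1 The canonical `2`-torsion abscissa -/

/-- **The canonical `2`-torsion abscissa.** For `V₀/ℤ₂` with `a₁ ∈ ℤ₂ˣ`: there is `X₀ ∈ ℤ₂ˣ` with
`X₀³ + b₂X₀² + 8b₄X₀ + 16b₆ = 0` and `X₀ + b₂ ∈ 2ℤ₂` (i.e. `‖X₀ + b₂‖ < 1`). [cite: SilvermanAEC2009, VII.3 Prop. 3.1] -/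
theorem exists_canonical_twoTorsionX (V₀ : WeierstrassCurve ℤ_[2]) (ha : IsUnit V₀.a₁) :
    ∃ X₀ : ℤ_[2], IsUnit X₀ ∧ X₀ ^ 3 + V₀.b₂ * X₀ ^ 2 + 8 * V₀.b₄ * X₀ + 16 * V₀.b₆ = 0 ∧ ‖X₀ + V₀.b₂‖ < 1 := by
  have h2 : ‖(2 : ℤ_[2])‖ < 1 := by
    have h : ‖((2 : ℕ) : ℤ_[2])‖ = ((2 : ℕ) : ℝ)⁻¹ := PadicInt.norm_p
    rw [Nat.cast_ofNat] at h
    rw [h]; norm_num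
  have ha1 : ‖V₀.a₁‖ = 1 := PadicInt.isUnit_iff.mp ha
  -- `b₂ = a₁² + 4a₂` is a unit
  have hb₂ : ‖V₀.b₂‖ = 1 := by
    have hsplit : V₀.b₂ = V₀.a₁ ^ 2 + 2 * (2 * V₀.a₂) := by rw [WeierstrassCurve.b₂]; ring
    have hbig : ‖V₀.a₁ ^ 2‖ = 1 := by rw [norm_pow, ha1, one_pow]
    have hsmall : ‖(2 : ℤ_[2]) * (2 * V₀.a₂)‖ < 1 := by
      rw [norm_mul]; exact mul_lt_one_of_nonneg_of_lt_one_left (norm_nonneg _) h2 (PadicInt.norm_le_one _)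
    rw [hsplit, PadicInt.norm_add_eq_max_of_ne (by rw [hbig]; exact hsmall.ne'), hbig, max_eq_left hsmall.le]
  set F : Polynomial ℤ_[2] :=
    Polynomial.X ^ 3 + Polynomial.C V₀.b₂ * Polynomial.X ^ 2 + Polynomial.C (8 * V₀.b₄) * Polynomial.X +
      Polynomial.C (16 * V₀.b₆) with hF
  have hFeval : ∀ z : ℤ_[2], F.aeval z = z ^ 3 + V₀.b₂ * z ^ 2 + 8 * V₀.b₄ * z + 16 * V₀.b₆ := by
    intro z; simp [hF]
  have hFder : ∀ z : ℤ_[2], F.derivative.aeval z = 3 * z ^ 2 + 2 * V₀.b₂ * z + 8 * V₀.b₄ := by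
    intro z; simp [hF]; ring
  set a : ℤ_[2] := -V₀.b₂ with ha'
  have hFa : F.aeval a = 2 * (8 * V₀.b₆ - 4 * V₀.b₂ * V₀.b₄) := by rw [hFeval, ha']; ring
  have hFda : F.derivative.aeval a = V₀.b₂ ^ 2 + 2 * (4 * V₀.b₄) := by rw [hFder, ha']; ring
  have hder1 : ‖F.derivative.aeval a‖ = 1 := by
    have hbig : ‖V₀.b₂ ^ 2‖ = 1 := by rw [norm_pow, hb₂, one_pow]
    have hsmall : ‖(2 : ℤ_[2]) * (4 * V₀.b₄)‖ < 1 := by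
      rw [norm_mul]; exact mul_lt_one_of_nonneg_of_lt_one_left (norm_nonneg _) h2 (PadicInt.norm_le_one _)
    rw [hFda, PadicInt.norm_add_eq_max_of_ne (by rw [hbig]; exact hsmall.ne'), hbig, max_eq_left hsmall.le]
  have hnorm : ‖F.aeval a‖ < ‖F.derivative.aeval a‖ ^ 2 := by
    rw [hder1, one_pow, hFa, norm_mul]
    exact mul_lt_one_of_nonneg_of_lt_one_left (norm_nonneg _) h2 (PadicInt.norm_le_one _)
  obtain ⟨X₀, hX₀, hdist, -⟩ := hensels_lemma hnorm
  rw [hder1] at hdist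
  have hsum : ‖X₀ + V₀.b₂‖ < 1 := by rw [show X₀ + V₀.b₂ = X₀ - a by rw [ha']; ring]; exact hdist
  refine ⟨X₀, ?_, by rw [← hFeval]; exact hX₀, hsum⟩
  -- `X₀ = -b₂ + (X₀ + b₂)` is a unit
  rw [PadicInt.isUnit_iff]
  have hbig : ‖-V₀.b₂‖ = 1 := by rw [norm_neg, hb₂]
  rw [show X₀ = -V₀.b₂ + (X₀ + V₀.b₂) by ring,
    PadicInt.norm_add_eq_max_of_ne (by rw [hbig]; exact hsum.ne'), hbig, max_eq_left hsum.le]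

/-- **Uniqueness of the canonical abscissa**: an odd root of `X³ + b₂X² + 8b₄X + 16b₆` is unique (the other roots — the étale
`2`-torsion abscissas times `4` — are `≡ 0 (mod 4)`). [cite: SilvermanAEC2009, VII.3 Prop. 3.1] -/
theorem canonical_twoTorsionX_unique (V₀ : WeierstrassCurve ℤ_[2]) (ha : IsUnit V₀.a₁) {X₁ X₂ : ℤ_[2]}
    (h₁ : X₁ ^ 3 + V₀.b₂ * X₁ ^ 2 + 8 * V₀.b₄ * X₁ + 16 * V₀.b₆ = 0) (hu₁ : ‖X₁ + V₀.b₂‖ < 1)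
    (h₂ : X₂ ^ 3 + V₀.b₂ * X₂ ^ 2 + 8 * V₀.b₄ * X₂ + 16 * V₀.b₆ = 0) (hu₂ : ‖X₂ + V₀.b₂‖ < 1) : X₁ = X₂ := by
  have h2 : ‖(2 : ℤ_[2])‖ < 1 := by
    have h : ‖((2 : ℕ) : ℤ_[2])‖ = ((2 : ℕ) : ℝ)⁻¹ := PadicInt.norm_p
    rw [Nat.cast_ofNat] at h
    rw [h]; norm_num
  have ha1 : ‖V₀.a₁‖ = 1 := PadicInt.isUnit_iff.mp ha
  have hb₂ : ‖V₀.b₂‖ = 1 := by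
    have hsplit : V₀.b₂ = V₀.a₁ ^ 2 + 2 * (2 * V₀.a₂) := by rw [WeierstrassCurve.b₂]; ring
    have hbig : ‖V₀.a₁ ^ 2‖ = 1 := by rw [norm_pow, ha1, one_pow]
    have hsmall : ‖(2 : ℤ_[2]) * (2 * V₀.a₂)‖ < 1 := by
      rw [norm_mul]; exact mul_lt_one_of_nonneg_of_lt_one_left (norm_nonneg _) h2 (PadicInt.norm_le_one _)
    rw [hsplit, PadicInt.norm_add_eq_max_of_ne (by rw [hbig]; exact hsmall.ne'), hbig, max_eq_left hsmall.le]
  -- `(X₁ − X₂)·(X₁² + X₁X₂ + X₂² + b₂(X₁ + X₂) + 8b₄) = 0`, and the second factor is `≡ b₂² (mod 2)`, a unit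
  have hfac : (X₁ - X₂) * (X₁ ^ 2 + X₁ * X₂ + X₂ ^ 2 + V₀.b₂ * (X₁ + X₂) + 8 * V₀.b₄) = 0 := by
    linear_combination h₁ - h₂
  set d₁ := X₁ + V₀.b₂ with hd₁
  set d₂ := X₂ + V₀.b₂ with hd₂
  have hunit : ‖X₁ ^ 2 + X₁ * X₂ + X₂ ^ 2 + V₀.b₂ * (X₁ + X₂) + 8 * V₀.b₄‖ = 1 := by
    have hrw : X₁ ^ 2 + X₁ * X₂ + X₂ ^ 2 + V₀.b₂ * (X₁ + X₂) + 8 * V₀.b₄ =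
        V₀.b₂ ^ 2 + (d₁ * (d₁ + d₂ - 2 * V₀.b₂) + d₂ * (d₂ - 2 * V₀.b₂) + 2 * (4 * V₀.b₄)) := by rw [hd₁, hd₂]; ring
    have hbig : ‖V₀.b₂ ^ 2‖ = 1 := by rw [norm_pow, hb₂, one_pow]
    have hsmall : ‖d₁ * (d₁ + d₂ - 2 * V₀.b₂) + d₂ * (d₂ - 2 * V₀.b₂) + 2 * (4 * V₀.b₄)‖ < 1 := by
      refine lt_of_le_of_lt (PadicInt.nonarchimedean _ _) (max_lt ?_ ?_)
      · refine lt_of_le_of_lt (PadicInt.nonarchimedean _ _) (max_lt ?_ ?_)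
        · rw [norm_mul]; exact mul_lt_one_of_nonneg_of_lt_one_left (norm_nonneg _) hu₁ (PadicInt.norm_le_one _)
        · rw [norm_mul]; exact mul_lt_one_of_nonneg_of_lt_one_left (norm_nonneg _) hu₂ (PadicInt.norm_le_one _)
      · rw [norm_mul]; exact mul_lt_one_of_nonneg_of_lt_one_left (norm_nonneg _) h2 (PadicInt.norm_le_one _)
    rw [hrw, PadicInt.norm_add_eq_max_of_ne (by rw [hbig]; exact hsmall.ne'), hbig, max_eq_left hsmall.le]
  have hne : X₁ ^ 2 + X₁ * X₂ + X₂ ^ 2 + V₀.b₂ * (X₁ + X₂) + 8 * V₀.b₄ ≠ 0 := fun h ↦ by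
    rw [h, norm_zero] at hunit; exact zero_ne_one hunit
  exact sub_eq_zero.mp ((mul_eq_zero.mp hfac).resolve_right hne)

/-- **`e = X₀/4` is a `2`-torsion abscissa of `V₀ ⊗ ℚ₂`**: `4e³ + b₂e² + 2b₄e + b₆ = 0` (the hypothesis `he` of the squared
`2`-isogeny functional equation), with `‖e‖₂ = 4` — the point `(e, −(a₁e + a₃)/2)` is the generator of the canonical subgroup,
in `Ê(2ℤ₂) ∖ Ê(4ℤ₂)`. [cite: SilvermanAEC2009, III.1 and VII.3 Prop. 3.1] -/
theorem twoTorsion_of_canonical (V₀ : WeierstrassCurve ℤ_[2]) {X₀ : ℤ_[2]} (hX : IsUnit X₀)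
    (h : X₀ ^ 3 + V₀.b₂ * X₀ ^ 2 + 8 * V₀.b₄ * X₀ + 16 * V₀.b₆ = 0) :
    4 * ((X₀ : ℚ_[2]) / 4) ^ 3 + (V₀.baseChange ℚ_[2]).b₂ * ((X₀ : ℚ_[2]) / 4) ^ 2 +
        2 * (V₀.baseChange ℚ_[2]).b₄ * ((X₀ : ℚ_[2]) / 4) + (V₀.baseChange ℚ_[2]).b₆ = 0 ∧
      ‖((X₀ : ℚ_[2]) / 4)‖ = 4 := by
  have hb2 : (V₀.baseChange ℚ_[2]).b₂ = (V₀.b₂ : ℚ_[2]) := by simp [WeierstrassCurve.baseChange]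
  have hb4 : (V₀.baseChange ℚ_[2]).b₄ = (V₀.b₄ : ℚ_[2]) := by simp [WeierstrassCurve.baseChange]
  have hb6 : (V₀.baseChange ℚ_[2]).b₆ = (V₀.b₆ : ℚ_[2]) := by simp [WeierstrassCurve.baseChange]
  have hQ : ((X₀ : ℚ_[2])) ^ 3 + (V₀.b₂ : ℚ_[2]) * (X₀ : ℚ_[2]) ^ 2 + 8 * (V₀.b₄ : ℚ_[2]) * X₀ + 16 * (V₀.b₆ : ℚ_[2]) = 0 := by
    exact_mod_cast congrArg ((↑) : ℤ_[2] → ℚ_[2]) h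
  refine ⟨?_, ?_⟩
  · rw [hb2, hb4, hb6]
    linear_combination hQ / 16
  · rw [norm_div, PadicInt.padic_norm_e_of_padicInt, PadicInt.isUnit_iff.mp hX]
    have h4 : ‖(4 : ℚ_[2])‖ = 4⁻¹ := by
      rw [show (4 : ℚ_[2]) = ((2 : ℕ) : ℚ_[2]) ^ 2 by norm_num, norm_pow, Padic.norm_p]; norm_num
    rw [h4]; norm_num

/-! ## §2 Normalised odd formal solutions for every constant -/

/-- **For EVERY constant `c` there is a normalised odd formal solution of `x + c = −D(Dσ/σ)`** on any `V/ℚ_p` (the tree gives one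
for some `c₀`; twist by `exp(((c₀ − c)/2)·log_V²)`). [cite: MazurSteinTate2006, Thm. 1.3] -/
theorem exists_isFormallyOdd_satisfiesSigmaODE_const {p : ℕ} [Fact p.Prime] (V : WeierstrassCurve ℚ_[p]) (c : ℚ_[p]) :
    ∃ σ : ℚ_[p]⟦X⟧, constantCoeff σ = 0 ∧ coeff 1 σ = 1 ∧ V.IsFormallyOdd σ ∧ V.SatisfiesSigmaODE σ c := by
  obtain ⟨σ₀, c₀, h0, h1, hodd, hODE⟩ := V.exists_isFormallyOdd_satisfiesSigmaODE
  obtain ⟨h0', h1', hODE'⟩ :=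
    WeierstrassCurve.SatisfiesSigmaODE.mul_exp_subst (V := V) h0 h1 hODE ((c₀ - c) / 2)
  refine ⟨_, h0', h1', hodd.mul_exp_subst _, ?_⟩
  convert hODE' using 1
  ring

end Summit.BirchSwinnertonDyer.BirchSwinnertonDyer.Theorems.AlignedTransportAtTwoSigmaSqTwo
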